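import Summits.AnomalousDissipation.AnomalousDissipation.Theses.MirrorEnsemble
import Summits.AnomalousDissipation.AnomalousDissipation.Theorems.MirrorStatisticsLoudTG.Negative.LoadBearing
import Summits.AnomalousDissipation.AnomalousDissipation.Theorems.MirrorEnsembleMirrorStatisticsLoudTGStubResidualK
import Summits.AnomalousDissipation.AnomalousDissipation.Theorems.EnsembleRigidityGPStatisticalRigidityLinearTestLimit
import Summits.AnomalousDissipation.AnomalousDissipation.Theorems.PumpedMirrorMirrorFloorTGSmallEnergy
import HarnessLib

/-!
# Disproof of `MirrorEnsemble.MirrorStatisticsLoudTG` (L_K, stmt-AnomalousDissipation-17693) — findings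

Seat `refuter-cdisprove-stmt-AnomalousDissipation-17693-0`, cycle 1 (2026-08-17). VERDICT SO FAR: **no kill**.
Every refutation of L_K needs a CONSTRUCTED family of quiet, bounded, mirror-supported stationary statistical
solutions (SSS) of NS_ν(f_TG) along `ν → 0`; no such object is constructible (tame enemy = cusped K-symmetric
steady Euler state, rough enemy = `ν^{1/3}` edge line-jets with an unsolved Prandtl–Batchelor outer problem), and
no junk model survives the definition (`prob`, Liouville identity, `e(μ) ≥ 0`). What IS kernel-checked here:

* §0 INHERITED (`Negative/LoadBearing`, rattack, p142856 — cited, not re-proved): `crux_iff` (sugar binder),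
  `loudAt_anti`/`loudAt_of_neg` (levels), `loudAtNoInt_iff` (the clause `Integrable ‖v‖²` is REDUNDANT),
  `eps_le_half_sqrt_of_loudAt` (constants window `ε₀ ≤ ½√E` once inhabited), `mirrorStatisticsLoudTG_false_without_sss`
  (the SSS clause is load-bearing: Dirac at rest), `not_mirrorStatisticsLoudTG_of_quietSteadyStates` (KILL SWITCH).
* §1 MEAN WORK-TEST BALANCE (new): every SSS `μ` of NS_ν(f_TG), `ν > 0`, has
  `|¼ + ∫ I_{f_TG} dμ| ≤ ‖∇f_TG‖₂ · (ν ε(μ))^{1/2}`, `I_{f_TG}(v) = ∫ (v ⊗ v) : ∇f_TG` the Reynolds stress against the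
  force (`sss_workBalance`; = landed `stub_residualK` + landed `stub_linearTestLimit` at `w = f_TG`, `Δf_TG = −12π²f_TG`,
  `‖f_TG‖² = ¼`). At `ν = 0` the pinning is EXACT: `∫ I_{f_TG} dμ = −¼` for every Euler SSS (landed meanwhile by the
  line's S3 tools file as `meanStress_tg`, with the energy floor `energyFloor_tg`; not duplicated here).
* §2 `sss_quarter_le`: `¼ ≤ C_TG e(μ) + L_TG (ν ε(μ))^{1/2}` for every SSS (no symmetry, no level).
* §3 ENERGY WINDOW — the level hypothesis `e(μ) ≤ E` is VACUOUS below a threshold: `∃ E₁ > 0 ∀ E ≤ E₁ ∃ ν₁ > 0`, NO SSS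
  of NS_ν(f_TG), `ν < ν₁`, has `e(μ) ≤ E` (`sss_level_empty_smallEnergy`); hence `LoudAt E ε₀ ν₀` holds there for EVERY
  `ε₀`, even absurd ones above the ceiling `½√E` (`loudAt_smallEnergy_any`). Every counterexample lives at `E > E₁`
  (`level_of_violation`).
* §4 THE FREE FLOOR IS O(ν): `∃ c > 0`, every SSS of NS_ν(f_TG), `0 < ν ≤ 1`, has `ε(μ) ≥ c ν` (`sss_dissipation_ge_linear`,
  no symmetry, no level). So `0 < ε₀` is free at each fixed `ν`; the crux's ENTIRE content is uniformity as `ν ↓ 0`.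
* §5 HYPOTHESIS MUTATION `0 < ν ↦ 0 ≤ ν`: the closed-endpoint body is equivalent to `LoudAt ∧` "no K-supported Euler
  SSS of energy `≤ E`" (`loudAtClosed_iff`) — the line's stub S3 (`stub_eulerCoerciveK`) restricted to the level is
  EXACTLY the price of the endpoint `ν = 0`; L_K itself does not pay it.
* §6 ENEMY ANATOMY: `QuietRoughFamily E → ¬L_K` (trivial socket of S4) and the checked necessary conditions a violating
  family obeys (energy `> E₁`, stress `→ −¼`, dissipation `≥ cν`). WHY IT RESISTS: see the docstrings of §6.
* §7 TARGETS: none registered (payload.stuck_stubs = []). Pre-attack of line `regimes`: S1 landed; S2's hypothesis class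
  is EMPTY for `E ≤ E₁`, `r < r₁` (`tameNear_empty_smallEnergy`) — vacuous there, its risk (escaping stress) untouched;
  S3 true below `1/(4C_TG)` (§3); S4 = crux + `G ≥ G₁`, no cheap model.

Landing: §1–§5 and §7 are filed as `Theorems/MirrorStatisticsLoudTG/Negative/EnergyWindow.lean` (p161920, `--supports` the
crux; dry-run ACCEPT); the enemy bookkeeping of §6 stays in this work file only.
-/

set_option linter.dupNamespace false

noncomputable section

namespace Summit.AnomalousDissipation.AnomalousDissipation.Cruxes.MirrorStatisticsLoudTG.Disproof

open MeasureTheory Filter Topology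
open scoped ENNReal InnerProductSpace
open Literature.Analysis.FunctionSpaces Literature.Analysis.FunctionSpaces.Torus Literature.Analysis.FluidPDE
open Summit.AnomalousDissipation.AnomalousDissipation.Theses.MirrorEnsemble
open Summit.AnomalousDissipation.AnomalousDissipation.Theorems.TaylorGreenLoudGalerkinStates.Negative
  (tgForce isSmooth_tgForce isDivFree_tgForce hasZeroMean_tgForce integral_norm_sq_tgForce)
open Summit.AnomalousDissipation.AnomalousDissipation.Theorems.MirrorStatisticsLoudTG.Negative
open Summit.AnomalousDissipation.AnomalousDissipation.Theorems.GPStatisticalRigidity.Negative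
  (integrable_norm_sq_of_ensembleEnstrophy_lt_top ensembleEnergy_nonneg)
open Summit.AnomalousDissipation.AnomalousDissipation.Theorems.EnsembleRigidity.GPStatisticalRigidity
  (stub_linearTestLimit)
open Summit.AnomalousDissipation.AnomalousDissipation.Theorems.PumpedMirrorMirrorFloorTG
  (laplacian_tgForce_apply exists_abs_inertialPairing_tg_le integral_norm_sq_le_ensembleEnstrophy)
open Summit.AnomalousDissipation.AnomalousDissipation.Theorems.TaylorCertificatesFloorCertificate
  (eigenforce_nsGeneratorPairing_self)
open Summit.AnomalousDissipation.AnomalousDissipation.Theorems.MirrorEnsembleMirrorStatisticsLoudTG (stub_residualK)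

/-- Local notation: the energy space `H` of `T³`. -/
local notation "H3" => Torus.energySpace (Fin 3)

/-! ## §1 Mean work-test balance for stationary statistical solutions of NS_ν(f_TG) -/

/-- Pointwise: the forced-Euler generator tested against the force itself is
`⟨f_TG − B(v,v), f_TG⟩ = ‖f_TG‖² + I_{f_TG}(v) = ¼ + I_{f_TG}(v)`. -/
theorem nsGeneratorPairing_zero_tg_self (v : H3) :
    Torus.nsGeneratorPairing 0 tgForce v tgForce = 4⁻¹ + Torus.inertialPairing v.1 tgForce := by
  rw [eigenforce_nsGeneratorPairing_self 0 (12 * Real.pi ^ 2) laplacian_tgForce_apply v, integral_norm_sq_tgForce]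
  ring

/-- `√(ν · ε(μ)) = ν √G(μ)` for `ν ≥ 0`. -/
theorem sqrt_nu_mul_ensembleDissipation {ν : ℝ} (hν : 0 ≤ ν) (μ : Measure H3) :
    Real.sqrt (ν * Torus.ensembleDissipation ν μ) = ν * Real.sqrt (Torus.ensembleEnstrophy μ).toReal := by
  rw [Torus.ensembleDissipation, ← mul_assoc, show ν * ν = ν ^ 2 by ring, Real.sqrt_mul (sq_nonneg ν),
    Real.sqrt_sq hν]

/-- **Linear balance from a cylindrical defect** (probability measure with integrable energy and forced-Euler
cylindrical defect `≤ R`): the Reynolds stress against `f_TG` is integrable and `|¼ + ∫ I_{f_TG} dμ| ≤ R ‖∇f_TG‖₂`. -/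
theorem workBalance_of_defect {μ : Measure H3} [IsProbabilityMeasure μ]
    (hint : Integrable (fun v : H3 => ‖v‖ ^ 2) μ) {R : ℝ}
    (hdef : ∀ Φ : Torus.CylindricalTest (Fin 3),
      Integrable (fun v : H3 => Torus.nsGeneratorPairing 0 tgForce v (Φ.grad v)) μ ∧
        |∫ v, Torus.nsGeneratorPairing 0 tgForce v (Φ.grad v) ∂μ| ≤
          R * Real.sqrt (∫ v, Torus.gradNormSq (Φ.grad v) ∂μ)) :
    Integrable (fun v : H3 => Torus.inertialPairing v.1 tgForce) μ ∧
      |4⁻¹ + ∫ v, Torus.inertialPairing v.1 tgForce ∂μ| ≤ R * Real.sqrt (Torus.gradNormSq tgForce) := by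
  obtain ⟨hI, hbal⟩ := stub_linearTestLimit tgForce tgForce memLp_tgForce isSmooth_tgForce isDivFree_tgForce
    hasZeroMean_tgForce μ inferInstance hint R hdef
  have hfun : (fun v : H3 => Torus.nsGeneratorPairing 0 tgForce v tgForce) =
      fun v => 4⁻¹ + Torus.inertialPairing v.1 tgForce := funext nsGeneratorPairing_zero_tg_self
  rw [hfun] at hI hbal
  have hI' : Integrable (fun v : H3 => Torus.inertialPairing v.1 tgForce) μ := by
    have h2 := hI.sub (integrable_const (4⁻¹ : ℝ))
    refine h2.congr (ae_of_all _ fun v => ?_)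
    simp
  refine ⟨hI', ?_⟩
  have hsplit : ∫ v, (4⁻¹ + Torus.inertialPairing v.1 tgForce) ∂μ =
      4⁻¹ + ∫ v, Torus.inertialPairing v.1 tgForce ∂μ := by
    rw [integral_add (integrable_const _) hI']
    simp
  rwa [hsplit] at hbal

/-- **Mean work-test balance for SSS of NS_ν(f_TG).** For every stationary statistical solution `μ` of
NS_ν(f_TG), `ν > 0` (integrable energy is automatic): `|¼ + ∫ I_{f_TG} dμ| ≤ ‖∇f_TG‖₂ (ν ε(μ))^{1/2}`.
Statistics of bounded dissipation cancel the force by Reynolds stress as `ν → 0`. -/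
theorem sss_workBalance {ν : ℝ} (hν : 0 < ν) {μ : Measure H3}
    (hμ : Torus.IsStationaryStatisticalSolution ν tgForce μ) :
    Integrable (fun v : H3 => Torus.inertialPairing v.1 tgForce) μ ∧
      |4⁻¹ + ∫ v, Torus.inertialPairing v.1 tgForce ∂μ| ≤
        Real.sqrt (Torus.gradNormSq tgForce) * Real.sqrt (ν * Torus.ensembleDissipation ν μ) := by
  haveI := hμ.prob
  have hint : Integrable (fun v : H3 => ‖v‖ ^ 2) μ :=
    integrable_norm_sq_of_ensembleEnstrophy_lt_top μ hμ.enstrophy_finite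
  obtain ⟨hI, hbal⟩ := workBalance_of_defect hint (stub_residualK ν μ hν hμ hint)
  refine ⟨hI, hbal.trans (le_of_eq ?_)⟩
  rw [sqrt_nu_mul_ensembleDissipation hν.le]
  ring

/-! ## §2 The quarter inequality -/

/-- **`¼ ≤ C_TG e(μ) + L_TG (ν ε(μ))^{1/2}`** for every SSS of NS_ν(f_TG), `ν > 0` — no symmetry, no level
(`C_TG = sup_x Σᵢ‖∂ᵢ f_TG(x)‖` bounds the stress, `|I_{f_TG}(v)| ≤ C_TG |v|²`; `L_TG = ‖∇f_TG‖₂`). -/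
theorem sss_quarter_le : ∃ C L : ℝ, 0 ≤ C ∧ 0 ≤ L ∧ ∀ (ν : ℝ) (μ : Measure H3), 0 < ν →
    Torus.IsStationaryStatisticalSolution ν tgForce μ →
      4⁻¹ ≤ C * Torus.ensembleEnergy μ + L * Real.sqrt (ν * Torus.ensembleDissipation ν μ) := by
  obtain ⟨C, hC0, hC⟩ := exists_abs_inertialPairing_tg_le
  refine ⟨C, Real.sqrt (Torus.gradNormSq tgForce), hC0, Real.sqrt_nonneg _, fun ν μ hν hμ => ?_⟩
  haveI := hμ.prob
  have hint : Integrable (fun v : H3 => ‖v‖ ^ 2) μ :=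
    integrable_norm_sq_of_ensembleEnstrophy_lt_top μ hμ.enstrophy_finite
  obtain ⟨hI, hbal⟩ := sss_workBalance hν hμ
  have hlow : -(C * Torus.ensembleEnergy μ) ≤ ∫ v, Torus.inertialPairing v.1 tgForce ∂μ := by
    rw [Torus.ensembleEnergy, ← integral_const_mul, ← integral_neg]
    refine integral_mono (hint.const_mul C).neg hI fun v => ?_
    have := neg_abs_le (Torus.inertialPairing v.1 tgForce)
    dsimp only
    linarith [hC v]
  have hup := (le_abs_self _).trans hbal
  linarith

/-! ## §3 ENERGY WINDOW: the level hypothesis is vacuous below `E₁` -/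

/-- **No stationary statistical solution of small energy.** There is `E₁ > 0` such that for every level
`E ≤ E₁` there is `ν₁ > 0` with: NO stationary statistical solution of NS_ν(f_TG), `0 < ν < ν₁`, has `e(μ) ≤ E`
(any support; `E₁ = 1/(8(C_TG+1))`, `ν₁ = 1/(256(L_TG+1)²)`). -/
theorem sss_level_empty_smallEnergy : ∃ E₁ : ℝ, 0 < E₁ ∧ ∀ E : ℝ, E ≤ E₁ → ∃ ν₁ : ℝ, 0 < ν₁ ∧
    ∀ (ν : ℝ) (μ : Measure H3), 0 < ν → ν < ν₁ → Torus.IsStationaryStatisticalSolution ν tgForce μ →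
      ¬ Torus.ensembleEnergy μ ≤ E := by
  obtain ⟨C, L, hC0, hL0, hq⟩ := sss_quarter_le
  refine ⟨1 / (8 * (C + 1)), by positivity, fun E hE => ⟨1 / (256 * (L + 1) ^ 2), by positivity,
    fun ν μ hν hν1 hμ hEμ => ?_⟩⟩
  haveI := hμ.prob
  have hint : Integrable (fun v : H3 => ‖v‖ ^ 2) μ :=
    integrable_norm_sq_of_ensembleEnstrophy_lt_top μ hμ.enstrophy_finite
  have h := hq ν μ hν hμ
  have he0 : 0 ≤ Torus.ensembleEnergy μ := ensembleEnergy_nonneg μ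
  have hE1 : E ≤ 1 := hE.trans (by
    rw [div_le_one (by positivity)]; nlinarith)
  -- the level term carries at most `1/8`
  have h1 : C * Torus.ensembleEnergy μ ≤ 8⁻¹ := by
    calc C * Torus.ensembleEnergy μ ≤ C * (1 / (8 * (C + 1))) :=
          mul_le_mul_of_nonneg_left (hEμ.trans hE) hC0
      _ ≤ (C + 1) * (1 / (8 * (C + 1))) := by
          apply mul_le_mul_of_nonneg_right (by linarith) (by positivity)
      _ = 8⁻¹ := by field_simp
  -- the dissipation is at most `½ √E ≤ 1`
  have hε0 : 0 ≤ Torus.ensembleDissipation ν μ := by rw [Torus.ensembleDissipation]; positivity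
  have hε1 : Torus.ensembleDissipation ν μ ≤ 1 := by
    have h2 := ensembleDissipation_le_half_sqrt hμ hint
    have h3 : Real.sqrt (Torus.ensembleEnergy μ) ≤ 1 := by
      rw [← Real.sqrt_one]; exact Real.sqrt_le_sqrt (hEμ.trans hE1)
    linarith
  -- hence `L √(ν ε) ≤ 1/16`
  have h4 : L * Real.sqrt (ν * Torus.ensembleDissipation ν μ) ≤ 16⁻¹ := by
    have hνε : ν * Torus.ensembleDissipation ν μ ≤ (1 / (16 * (L + 1))) ^ 2 := by
      calc ν * Torus.ensembleDissipation ν μ ≤ ν * 1 := mul_le_mul_of_nonneg_left hε1 hν.le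
        _ ≤ 1 / (256 * (L + 1) ^ 2) := by linarith
        _ = (1 / (16 * (L + 1))) ^ 2 := by field_simp; ring
    have hs : Real.sqrt (ν * Torus.ensembleDissipation ν μ) ≤ 1 / (16 * (L + 1)) := by
      rw [← Real.sqrt_sq (by positivity : (0 : ℝ) ≤ 1 / (16 * (L + 1)))]
      exact Real.sqrt_le_sqrt hνε
    calc L * Real.sqrt (ν * Torus.ensembleDissipation ν μ) ≤ L * (1 / (16 * (L + 1))) :=
          mul_le_mul_of_nonneg_left hs hL0
      _ ≤ (L + 1) * (1 / (16 * (L + 1))) := mul_le_mul_of_nonneg_right (by linarith) (by positivity)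
      _ = 16⁻¹ := by field_simp
  linarith

/-- **Vacuity made visible.** Below `E₁` the body `LoudAt E ε₀ ν₀` of the crux holds for EVERY constant `ε₀`
— including constants above the dissipation ceiling `½√E` of `eps_le_half_sqrt_of_loudAt` — as soon as
`ν₀ ≤ ν₁(E)`: the hypothesis class is empty there, so the crux has no content below `E₁`. -/
theorem loudAt_smallEnergy_any : ∃ E₁ : ℝ, 0 < E₁ ∧ ∀ E : ℝ, E ≤ E₁ → ∃ ν₁ : ℝ, 0 < ν₁ ∧
    ∀ ε₀ ν₀ : ℝ, ν₀ ≤ ν₁ → LoudAt E ε₀ ν₀ := by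
  obtain ⟨E₁, hE₁, h⟩ := sss_level_empty_smallEnergy
  refine ⟨E₁, hE₁, fun E hE => ?_⟩
  obtain ⟨ν₁, hν₁, hno⟩ := h E hE
  exact ⟨ν₁, hν₁, fun ε₀ ν₀ hν₀ ν hν hνlt μ hμ _ hEμ _ =>
    absurd hEμ (hno ν μ hν (hνlt.trans_le hν₀) hμ)⟩

/-- **Every counterexample lives above `E₁`.** If the crux fails, the violating level `E` exceeds `E₁`. -/
theorem level_of_violation (h : ¬ MirrorStatisticsLoudTG) :
    ∃ E₁ : ℝ, 0 < E₁ ∧ ∃ E : ℝ, E₁ < E ∧ ¬ ∃ ε₀ ν₀ : ℝ, 0 < ε₀ ∧ 0 < ν₀ ∧ LoudAt E ε₀ ν₀ := by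
  obtain ⟨E₁, hE₁, hwin⟩ := loudAt_smallEnergy_any
  rw [crux_iff] at h
  push Not at h
  obtain ⟨E, hE⟩ := h
  refine ⟨E₁, hE₁, E, ?_, ?_⟩
  · by_contra hle
    obtain ⟨ν₁, hν₁, hl⟩ := hwin E (not_lt.1 hle)
    exact hE 1 ν₁ one_pos hν₁ (hl 1 ν₁ le_rfl)
  · rintro ⟨ε₀, ν₀, hε₀, hν₀, hl⟩
    exact hE ε₀ ν₀ hε₀ hν₀ hl

/-! ## §4 THE FREE FLOOR IS `O(ν)` -/

/-- **Fixed-viscosity loudness is free.** There is `c > 0` (depending on f_TG only) such that EVERY stationary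
statistical solution of NS_ν(f_TG), `0 < ν ≤ 1` — no symmetry, no energy level — dissipates at least `c ν`
(quarter inequality + Poincaré in the mean `4π² e(μ) ≤ G(μ)`). The crux asks for `ε₀(E)` uniform in `ν`;
that uniformity is its entire open content. -/
theorem sss_dissipation_ge_linear : ∃ c : ℝ, 0 < c ∧ ∀ (ν : ℝ) (μ : Measure H3), 0 < ν → ν ≤ 1 →
    Torus.IsStationaryStatisticalSolution ν tgForce μ → c * ν ≤ Torus.ensembleDissipation ν μ := by
  obtain ⟨C, L, hC0, hL0, hq⟩ := sss_quarter_le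
  refine ⟨min (Real.pi ^ 2 / (2 * (C + 1))) (1 / (256 * (L + 1) ^ 2)), lt_min (by positivity) (by positivity),
    fun ν μ hν hν1 hμ => ?_⟩
  haveI := hμ.prob
  have h := hq ν μ hν hμ
  set ε := Torus.ensembleDissipation ν μ with hε
  set c := min (Real.pi ^ 2 / (2 * (C + 1))) (1 / (256 * (L + 1) ^ 2)) with hc
  have hε0 : 0 ≤ ε := by rw [hε, Torus.ensembleDissipation]; positivity
  by_contra hlt
  rw [not_le] at hlt
  -- Poincaré in the mean: `C e ≤ C ε/(4π²ν) < C c/(4π²) ≤ 1/8`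
  have hP := integral_norm_sq_le_ensembleEnstrophy μ hμ.enstrophy_finite
  have he : Torus.ensembleEnergy μ ≤ ε / (4 * Real.pi ^ 2 * ν) := by
    rw [le_div_iff₀ (by positivity), hε, Torus.ensembleDissipation, Torus.ensembleEnergy]
    nlinarith
  have h1 : C * Torus.ensembleEnergy μ ≤ 8⁻¹ := by
    have hcν : ε / (4 * Real.pi ^ 2 * ν) ≤ c / (4 * Real.pi ^ 2) := by
      rw [div_le_div_iff₀ (by positivity) (by positivity)]
      nlinarith [Real.pi_pos]
    have hc1 : c ≤ Real.pi ^ 2 / (2 * (C + 1)) := min_le_left _ _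
    calc C * Torus.ensembleEnergy μ ≤ C * (c / (4 * Real.pi ^ 2)) :=
          mul_le_mul_of_nonneg_left (he.trans hcν) hC0
      _ ≤ C * (Real.pi ^ 2 / (2 * (C + 1)) / (4 * Real.pi ^ 2)) := by gcongr
      _ = C / (8 * (C + 1)) := by field_simp; ring
      _ ≤ (C + 1) / (8 * (C + 1)) := by gcongr; linarith
      _ = 8⁻¹ := by field_simp
  -- `L √(ν ε) ≤ 1/16`
  have h4 : L * Real.sqrt (ν * ε) ≤ 16⁻¹ := by
    have hνε : ν * ε ≤ (1 / (16 * (L + 1))) ^ 2 := by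
      have hc2 : c ≤ 1 / (256 * (L + 1) ^ 2) := min_le_right _ _
      have hc0 : 0 ≤ c := le_min (by positivity) (by positivity)
      have a1 : ν * ε ≤ ν * (c * ν) := mul_le_mul_of_nonneg_left hlt.le hν.le
      have hνν : ν * ν ≤ 1 := by nlinarith
      have a2 : ν * (c * ν) ≤ c := by
        calc ν * (c * ν) = c * (ν * ν) := by ring
          _ ≤ c := mul_le_of_le_one_right hc0 hνν
      calc ν * ε ≤ c := a1.trans a2
        _ ≤ 1 / (256 * (L + 1) ^ 2) := hc2
        _ = (1 / (16 * (L + 1))) ^ 2 := by field_simp; ring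
    have hs : Real.sqrt (ν * ε) ≤ 1 / (16 * (L + 1)) := by
      rw [← Real.sqrt_sq (by positivity : (0 : ℝ) ≤ 1 / (16 * (L + 1)))]
      exact Real.sqrt_le_sqrt hνε
    calc L * Real.sqrt (ν * ε) ≤ L * (1 / (16 * (L + 1))) := mul_le_mul_of_nonneg_left hs hL0
      _ ≤ (L + 1) * (1 / (16 * (L + 1))) := mul_le_mul_of_nonneg_right (by linarith) (by positivity)
      _ = 16⁻¹ := by field_simp
  linarith

/-! ## §5 Hypothesis mutation: the endpoint `ν = 0` -/

/-- The `∀ ν ∀ μ` body of the crux with `0 < ν` WEAKENED to `0 ≤ ν`. -/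
def LoudAtClosed (E ε₀ ν₀ : ℝ) : Prop :=
  ∀ ν : ℝ, 0 ≤ ν → ν < ν₀ → ∀ μ : Measure H3,
    Torus.IsStationaryStatisticalSolution ν tgForce μ →
      Integrable (fun v : H3 => ‖v‖ ^ 2) μ → Torus.ensembleEnergy μ ≤ E →
        μ (closure mirrorClass)ᶜ = 0 → ε₀ ≤ Torus.ensembleDissipation ν μ

/-- **The endpoint costs exactly bounded-energy K-Euler coercivity.** For `ε₀, ν₀ > 0`, the closed body is
equivalent to the crux's body AND "no K-supported stationary statistical solution of Euler forced by f_TG has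
energy `≤ E`" — the line's stub S3 restricted to the level. (At `ν = 0` the dissipation `ν G` vanishes
identically, so any K-Euler SSS of energy `≤ E` kills the closed body.) -/
theorem loudAtClosed_iff {E ε₀ ν₀ : ℝ} (hε₀ : 0 < ε₀) (hν₀ : 0 < ν₀) :
    LoudAtClosed E ε₀ ν₀ ↔ LoudAt E ε₀ ν₀ ∧ ∀ μ : Measure H3,
      Torus.IsStationaryStatisticalSolution 0 tgForce μ → Torus.ensembleEnergy μ ≤ E →
        μ (closure mirrorClass)ᶜ = 0 → False := by
  constructor
  · intro h
    refine ⟨fun ν hν hνlt μ hμ hI hE hS => h ν hν.le hνlt μ hμ hI hE hS, fun μ hμ hE hS => ?_⟩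
    haveI := hμ.prob
    have hI : Integrable (fun v : H3 => ‖v‖ ^ 2) μ :=
      integrable_norm_sq_of_ensembleEnstrophy_lt_top μ hμ.enstrophy_finite
    have key := h 0 le_rfl hν₀ μ hμ hI hE hS
    rw [Torus.ensembleDissipation, zero_mul] at key
    exact absurd key (not_le.2 hε₀)
  · rintro ⟨hl, hN⟩ ν hν hνlt μ hμ hI hE hS
    rcases hν.eq_or_lt with h0 | hpos
    · subst h0
      exact (hN μ hμ hE hS).elim
    · exact hl ν hpos hνlt μ hμ hI hE hS

/-! ## §6 Enemy anatomy (why the crux resists) -/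

/-- **ENEMY (rough): a quiet bounded K-supported family with diverging mean enstrophy.** Along `νₙ → 0⁺`:
K-supported SSS `μₙ` of NS_{νₙ}(f_TG) with `e(μₙ) ≤ E`, `G(μₙ) → ∞` and `νₙ G(μₙ) → 0`. WHY IT RESISTS
CONSTRUCTION: dimensionally admissible (edge line-jets of width `δ ~ ν^{1/3}` and speed `~ ν^{-1/3}` on the symmetry
skeleton carry energy `O(1)`, dissipation `~ ν^{1/3}` and balance the Kelvin pumping `∮_C f_TG·dl = 4/π`
viscously), but the outer flow must be a bounded-energy K-symmetric steady Euler flow with Prandtl–Batchelor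
solvability on every closed streamline — no 3-D construction exists; the in-tree Newton census of steady
K-branches shows runaway (`E ~ ν^{-0.7}`, `νW ≈ 0.25`) instead. WHY IT RESISTS EXCLUSION: it is the statistical
face of the 3-D energy-equality problem (silent leak: input `∫(u,f_TG)dμ` may stay `≥ η` while `νG → 0`). -/
def QuietRoughFamily (E : ℝ) : Prop :=
  ∃ (νs : ℕ → ℝ) (μ : ℕ → Measure H3), (∀ n, 0 < νs n) ∧ Tendsto νs atTop (𝓝 0) ∧
    (∀ n, Torus.IsStationaryStatisticalSolution (νs n) tgForce (μ n)) ∧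
    (∀ n, Torus.ensembleEnergy (μ n) ≤ E) ∧ (∀ n, μ n (closure mirrorClass)ᶜ = 0) ∧
    Tendsto (fun n => (Torus.ensembleEnstrophy (μ n)).toReal) atTop atTop ∧
    Tendsto (fun n => Torus.ensembleDissipation (νs n) (μ n)) atTop (𝓝 0)

/-- **ENEMY (tame): a quiet bounded K-supported family with bounded mean enstrophy.** WHY IT RESISTS: its weak
limits are exact K-supported Euler statistics (line stub S2), which must carry an EDGE CUSP of enstrophy on the
skeleton loop (statistical Kelvin tube law) and pin the stress `∫ I_{f_TG} dμ = −¼` (landed `meanStress_tg`) with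
energy `≥ E₀` (landed `energyFloor_tg`); no cusped K-symmetric steady Euler state is known. The Dirac
sub-case is the kill switch `not_mirrorStatisticsLoudTG_of_quietSteadyStates` of `Negative/LoadBearing`. -/
def QuietTameFamily (E : ℝ) : Prop :=
  ∃ (νs : ℕ → ℝ) (μ : ℕ → Measure H3) (G₁ : ℝ), (∀ n, 0 < νs n) ∧ Tendsto νs atTop (𝓝 0) ∧
    (∀ n, Torus.IsStationaryStatisticalSolution (νs n) tgForce (μ n)) ∧
    (∀ n, Torus.ensembleEnergy (μ n) ≤ E) ∧ (∀ n, μ n (closure mirrorClass)ᶜ = 0) ∧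
    (∀ n, (Torus.ensembleEnstrophy (μ n)).toReal ≤ G₁)

/-- A quiet rough family kills the crux (the socket of stub S4). -/
theorem not_crux_of_quietRoughFamily {E : ℝ} (h : QuietRoughFamily E) : ¬ MirrorStatisticsLoudTG := by
  intro hc
  obtain ⟨νs, μ, hν, hν0, hsss, hE, hK, -, hquiet⟩ := h
  obtain ⟨ε₀, ν₀, hε₀, hν₀, hl⟩ := (crux_iff.1 hc) E
  have h1 : ∀ᶠ n in atTop, νs n < ν₀ := hν0.eventually (gt_mem_nhds hν₀)
  have h2 : ∀ᶠ n in atTop, Torus.ensembleDissipation (νs n) (μ n) < ε₀ := hquiet.eventually (gt_mem_nhds hε₀)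
  obtain ⟨n, hn1, hn2⟩ := (h1.and h2).exists
  haveI := (hsss n).prob
  have hI : Integrable (fun v : H3 => ‖v‖ ^ 2) (μ n) :=
    integrable_norm_sq_of_ensembleEnstrophy_lt_top (μ n) (hsss n).enstrophy_finite
  exact absurd (hl (νs n) (hν n) hn1 (μ n) (hsss n) hI (hE n) (hK n)) (not_le.2 hn2)

/-- A tame bounded family is AUTOMATICALLY quiet (`νₙ G ≤ νₙ G₁ → 0`) and kills the crux. -/
theorem not_crux_of_quietTameFamily {E : ℝ} (h : QuietTameFamily E) : ¬ MirrorStatisticsLoudTG := by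
  intro hc
  obtain ⟨νs, μ, G₁, hν, hν0, hsss, hE, hK, hG⟩ := h
  obtain ⟨ε₀, ν₀, hε₀, hν₀, hl⟩ := (crux_iff.1 hc) E
  have hG₁ : 0 ≤ G₁ := (ENNReal.toReal_nonneg).trans (hG 0)
  -- `νₙ (G₁ + 1) → 0`, so eventually `νₙ G(μₙ) ≤ νₙ G₁ < ε₀`
  have ht : Tendsto (fun n => νs n * (G₁ + 1)) atTop (𝓝 0) := by
    simpa using hν0.mul_const (G₁ + 1)
  have h1 : ∀ᶠ n in atTop, νs n < ν₀ := hν0.eventually (gt_mem_nhds hν₀)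
  have h2 : ∀ᶠ n in atTop, νs n * (G₁ + 1) < ε₀ := ht.eventually (gt_mem_nhds hε₀)
  obtain ⟨n, hn1, hn2⟩ := (h1.and h2).exists
  haveI := (hsss n).prob
  have hI : Integrable (fun v : H3 => ‖v‖ ^ 2) (μ n) :=
    integrable_norm_sq_of_ensembleEnstrophy_lt_top (μ n) (hsss n).enstrophy_finite
  have key := hl (νs n) (hν n) hn1 (μ n) (hsss n) hI (hE n) (hK n)
  have hD : Torus.ensembleDissipation (νs n) (μ n) ≤ νs n * (G₁ + 1) := by
    rw [Torus.ensembleDissipation]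
    exact mul_le_mul_of_nonneg_left ((hG n).trans (by linarith)) (hν n).le
  linarith

/-- **Checked anatomy of a violation.** If the crux fails at level `E` with constants `c, L` of §2/§4 in hand,
then for all `ε₀, ν₀ ∈ (0,1]` there is a K-supported SSS at some `ν < ν₀` with energy `≤ E`, dissipation in the
window `[cν, ε₀)` and Reynolds stress pinned: `|¼ + ∫ I_{f_TG} dμ| ≤ L (ν ε₀)^{1/2}`. -/
theorem anatomy_of_violation {E : ℝ} (h : ¬ ∃ ε₀ ν₀ : ℝ, 0 < ε₀ ∧ 0 < ν₀ ∧ LoudAt E ε₀ ν₀) :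
    ∃ c L : ℝ, 0 < c ∧ 0 ≤ L ∧ ∀ ε₀ ν₀ : ℝ, 0 < ε₀ → 0 < ν₀ → ν₀ ≤ 1 →
      ∃ (ν : ℝ) (μ : Measure H3), 0 < ν ∧ ν < ν₀ ∧ Torus.IsStationaryStatisticalSolution ν tgForce μ ∧
        Torus.ensembleEnergy μ ≤ E ∧ μ (closure mirrorClass)ᶜ = 0 ∧
        Torus.ensembleDissipation ν μ < ε₀ ∧ c * ν ≤ Torus.ensembleDissipation ν μ ∧
        |4⁻¹ + ∫ v, Torus.inertialPairing v.1 tgForce ∂μ| ≤ L * Real.sqrt (ν * ε₀) := by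
  obtain ⟨c, hc, hfloor⟩ := sss_dissipation_ge_linear
  refine ⟨c, Real.sqrt (Torus.gradNormSq tgForce), hc, Real.sqrt_nonneg _, fun ε₀ ν₀ hε₀ hν₀ hν₀1 => ?_⟩
  have h' : ¬ LoudAt E ε₀ ν₀ := fun hl => h ⟨ε₀, ν₀, hε₀, hν₀, hl⟩
  unfold LoudAt at h'
  push Not at h'
  obtain ⟨ν, hν, hνlt, μ, hμ, -, hE, hS, hquiet⟩ := h'
  obtain ⟨-, hbal⟩ := sss_workBalance hν hμ
  refine ⟨ν, μ, hν, hνlt, hμ, hE, hS, hquiet, hfloor ν μ hν (hνlt.le.trans hν₀1) hμ, hbal.trans ?_⟩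
  exact mul_le_mul_of_nonneg_left (Real.sqrt_le_sqrt (mul_le_mul_of_nonneg_left hquiet.le hν.le))
    (Real.sqrt_nonneg _)

/-! ## §7 Targets (line `regimes`): pre-attack of the stubs

No stuck stubs are registered (payload.stuck_stubs = []). S1 `stub_residualK` is LANDED
(`MirrorEnsembleMirrorStatisticsLoudTGStubResidualK`). S2's hypothesis class is EMPTY at small energy and small
defect — the stub is vacuous there (its genuine risk, escaping Reynolds stress at infinite energy, cannot be
exhibited without constructing near-statistics). S3 holds below `1/(4C_TG)` (§3). S4 has no finite model. -/

/-- **S2's hypothesis class is empty at small energy / small defect**: a probability measure with integrable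
energy `e(μ) ≤ E ≤ E₁` cannot have forced-Euler cylindrical defect `≤ r` for `r < r₁` (the tame near-statistics
of `stub_tameClosureK` do not exist there, so the stub is vacuous at such `(E, r)`). -/
theorem tameNear_empty_smallEnergy : ∃ E₁ r₁ : ℝ, 0 < E₁ ∧ 0 < r₁ ∧ ∀ (E r : ℝ) (μ : Measure H3), E ≤ E₁ → r < r₁ →
    IsProbabilityMeasure μ → Integrable (fun v : H3 => ‖v‖ ^ 2) μ → Torus.ensembleEnergy μ ≤ E →
    (∀ Φ : Torus.CylindricalTest (Fin 3),
      Integrable (fun v : H3 => Torus.nsGeneratorPairing 0 tgForce v (Φ.grad v)) μ ∧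
        |∫ v, Torus.nsGeneratorPairing 0 tgForce v (Φ.grad v) ∂μ| ≤
          r * Real.sqrt (∫ v, Torus.gradNormSq (Φ.grad v) ∂μ)) → False := by
  obtain ⟨C, hC0, hC⟩ := exists_abs_inertialPairing_tg_le
  set L := Real.sqrt (Torus.gradNormSq tgForce) with hL
  have hL0 : 0 ≤ L := Real.sqrt_nonneg _
  refine ⟨1 / (8 * (C + 1)), 1 / (16 * (L + 1)), by positivity, by positivity,
    fun E r μ hE hr hP hint hEμ hdef => ?_⟩
  obtain ⟨hI, hbal⟩ := workBalance_of_defect hint hdef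
  have hlow : -(C * Torus.ensembleEnergy μ) ≤ ∫ v, Torus.inertialPairing v.1 tgForce ∂μ := by
    rw [Torus.ensembleEnergy, ← integral_const_mul, ← integral_neg]
    refine integral_mono (hint.const_mul C).neg hI fun v => ?_
    have := neg_abs_le (Torus.inertialPairing v.1 tgForce)
    dsimp only
    linarith [hC v]
  have h1 : C * Torus.ensembleEnergy μ ≤ 8⁻¹ := by
    calc C * Torus.ensembleEnergy μ ≤ C * (1 / (8 * (C + 1))) :=
          mul_le_mul_of_nonneg_left (hEμ.trans hE) hC0
      _ ≤ (C + 1) * (1 / (8 * (C + 1))) := by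
          apply mul_le_mul_of_nonneg_right (by linarith) (by positivity)
      _ = 8⁻¹ := by field_simp
  have h2 : r * L ≤ 16⁻¹ := by
    rcases le_or_gt r 0 with hr0 | hr0
    · have : r * L ≤ 0 := mul_nonpos_of_nonpos_of_nonneg hr0 hL0
      linarith
    · calc r * L ≤ (1 / (16 * (L + 1))) * L := mul_le_mul_of_nonneg_right hr.le hL0
        _ ≤ (1 / (16 * (L + 1))) * (L + 1) := mul_le_mul_of_nonneg_left (by linarith) (by positivity)
        _ = 16⁻¹ := by field_simp
  have hup := (le_abs_self _).trans hbal
  linarith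

end Summit.AnomalousDissipation.AnomalousDissipation.Cruxes.MirrorStatisticsLoudTG.Disproof

end
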